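import Literature.NumberTheory.Automorphic.WhittakerTowerCoeff
import Literature.NumberTheory.Automorphic.WhittakerTowerEquivariance
import Literature.NumberTheory.Automorphic.CuspFormsRapidDecayLevel
import Mathlib.LinearAlgebra.Matrix.Transvection
import HarnessLib

/-!
# Support of Whittaker functions at the finite places: `W_φ(a k) ≠ 0 ⟹ |a_j / a_{j+1}|_v ≪ 1`

Topic `NumberTheory/Automorphic`; namespace `Literature.NumberTheory.Automorphic`. Let `φ` be a left
`GL_n(K)`-invariant function on `GL_n(𝔸_K)`, right-invariant under the principal congruence subgroup
`K(𝔫)` (`principalCongruenceLevel`, `𝔫 ≠ 0`), with global Whittaker function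
`W_φ = whittakerDepth 0 φ` (Tate's character `ψ`). If the finite component of `g` is `g_f = a · k`
with `a = diag(t)` and `k ∈ GL_n(𝒪̂_K)`, then for a finite place `v`, a simple root `(j, j+1)` and
`x ∈ K_v` with `ψ_v(x) ≠ 1`,

  `W_φ(g) ≠ 0 ⟹ |t_j|_v · |𝔫|_v < |x|_v · |t_{j+1}|_v`

(`valued_lt_of_whittakerDepth_zero_ne_zero`): otherwise the elementary unipotent `u = 1 + x E_{j,j+1}`
(placed at `v`) satisfies `g⁻¹ u g ∈ K(𝔫)`, so `W_φ(g) = W_φ(g · g⁻¹ u g) = W_φ(u g) = ψ_v(x) W_φ(g)`.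
Since `ψ_v ≠ 1` at every `v` and `ψ_v` is unramified almost everywhere
(`Tate1950_adicComponent_adeleAddChar_holds`), this confines the torus part of the finite Iwasawa
coordinates of the support of `W_φ` to `|t_j / t_{j+1}|_v ≤ C_v`, `C_v = 1` for almost all `v` —
the finite half of the estimates by which the Fourier expansion of a cusp form converges absolutely
(Cogdell (2004), Thm. 1.1; Jacquet–Piatetski-Shapiro–Shalika: Whittaker functions are supported on
`|α_j(a)| ≤ C`). Ingredients proved here: the elementary unipotents `transvectionUnit` over any
commutative ring (Mathlib's `Matrix.transvection` as a unit), their behaviour under ring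
homomorphisms, diagonal conjugation and the generic character; membership of `(1, 1 + c E_{ij})` in
`K(𝔫)` and normality of `K(𝔫)` under `GL_n(𝒪̂_K)`; right-invariance of the Whittaker tower.

## References

* J. W. Cogdell, *Analytic theory of L-functions for GL_n*, in *An Introduction to the Langlands
  Program* (2004), §1.1, Thm. 1.1 [CogdellAnalyticTheory2004].
* J. Tate, *Fourier analysis in number fields and Hecke's zeta-functions*, in Cassels–Fröhlich
  (1967), Ch. XV, Lemma 2.2.3 [CasselsFrohlichANT1967].
-/

noncomputable section

open MeasureTheory NumberField IsDedekindDomain Matrix Set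
open scoped MatrixGroups

namespace Literature.NumberTheory.Automorphic

/-! ### Elementary unipotents over a commutative ring -/

section Transvection

variable {n : ℕ} {R : Type*} [CommRing R]

/-- **The elementary unipotent `1 + c E_{ij}` (`i ≠ j`) as an invertible matrix** over any
commutative ring (Mathlib's `Matrix.transvection`, with inverse `1 - c E_{ij}`). [folklore] -/
def transvectionUnit (i j : Fin n) (hij : i ≠ j) (c : R) : GL (Fin n) R :=
  ⟨Matrix.transvection i j c, Matrix.transvection i j (-c),
    by rw [Matrix.transvection_mul_transvection_same i j hij, add_neg_cancel, Matrix.transvection_zero],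
    by rw [Matrix.transvection_mul_transvection_same i j hij, neg_add_cancel, Matrix.transvection_zero]⟩

/-- The matrix of `transvectionUnit i j hij c` is `1 + single i j c`. [folklore] -/
@[simp]
theorem coe_transvectionUnit (i j : Fin n) (hij : i ≠ j) (c : R) :
    ((transvectionUnit i j hij c : GL (Fin n) R) : Matrix (Fin n) (Fin n) R) = 1 + Matrix.single i j c :=
  rfl

/-- The inverse of `1 + c E_{ij}` is `1 - c E_{ij}`. [folklore] -/
theorem transvectionUnit_inv (i j : Fin n) (hij : i ≠ j) (c : R) :
    (transvectionUnit i j hij c)⁻¹ = transvectionUnit i j hij (-c) :=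
  Units.ext rfl

/-- `transvectionUnit i j hij 0 = 1`. [folklore] -/
@[simp]
theorem transvectionUnit_zero (i j : Fin n) (hij : i ≠ j) :
    transvectionUnit i j hij (0 : R) = 1 :=
  Units.ext (Matrix.transvection_zero i j)

/-- Elementary unipotents are mapped to elementary unipotents by ring homomorphisms. [folklore] -/
theorem map_transvectionUnit {S : Type*} [CommRing S] (f : R →+* S) (i j : Fin n) (hij : i ≠ j) (c : R) :
    Matrix.GeneralLinearGroup.map f (transvectionUnit i j hij c) = transvectionUnit i j hij (f c) := by
  refine Units.ext (Matrix.ext fun a b => ?_)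
  rw [Matrix.GeneralLinearGroup.map_apply, coe_transvectionUnit, coe_transvectionUnit, Matrix.add_apply,
    Matrix.add_apply, map_add, Matrix.one_apply, Matrix.one_apply, Matrix.single_apply, Matrix.single_apply]
  split_ifs <;> simp

/-- `1 + c E_{ij}` is upper unitriangular for `i < j`. [folklore] -/
theorem transvectionUnit_mem_upperUnitriangular {i j : Fin n} (hij : i < j) (c : R) :
    transvectionUnit i j hij.ne c ∈ upperUnitriangular (Fin n) R := by
  rw [mem_upperUnitriangular_iff, coe_transvectionUnit]
  refine ⟨fun a b hba => ?_, fun a => ?_⟩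
  · have hba' : b < a := hba
    rw [Matrix.add_apply, Matrix.one_apply_ne (ne_of_gt hba'), Matrix.single_apply, if_neg, add_zero]
    rintro ⟨rfl, rfl⟩
    exact absurd (hij.trans hba') (lt_irrefl _)
  · rw [Matrix.add_apply, Matrix.one_apply_eq, Matrix.single_apply, if_neg, add_zero]
    rintro ⟨rfl, rfl⟩
    exact absurd hij (lt_irrefl _)

/-- **Conjugating an elementary unipotent by a diagonal matrix**:
`diag(t)⁻¹ (1 + c E_{ij}) diag(t) = 1 + tᵢ⁻¹ c tⱼ E_{ij}`. [folklore] -/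
theorem glDiagonal_inv_mul_transvectionUnit_mul_glDiagonal (t : Fin n → Rˣ) (i j : Fin n) (hij : i ≠ j) (c : R) :
    (glDiagonal n R t)⁻¹ * transvectionUnit i j hij c * glDiagonal n R t =
      transvectionUnit i j hij ((((t i)⁻¹ : Rˣ) : R) * c * t j) := by
  refine Units.ext (Matrix.ext fun a b => ?_)
  rw [Units.val_mul, Units.val_mul, ← map_inv, coe_glDiagonal, coe_glDiagonal, coe_transvectionUnit,
    coe_transvectionUnit, Matrix.mul_diagonal, Matrix.diagonal_mul, Matrix.add_apply, Matrix.add_apply,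
    Matrix.single_apply, Matrix.single_apply, Matrix.one_apply, Pi.inv_apply]
  by_cases hab : a = b
  · subst hab
    rw [if_pos rfl, if_neg (fun h => hij (h.1.trans h.2.symm)), if_neg (fun h => hij (h.1.trans h.2.symm)),
      add_zero, mul_one, Units.inv_mul]
  · rw [if_neg hab, zero_add, zero_add]
    split_ifs with h
    · obtain ⟨rfl, rfl⟩ := h; ring
    · rw [mul_zero, zero_mul]

/-- **The superdiagonal sum of `1 + c E_{j,j+1}` is `c`.** [folklore] -/
theorem superdiagSumFrom_one_transvectionUnit {j : ℕ} (hj : j + 1 < n) (c : R) :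
    superdiagSumFrom 1 ((transvectionUnit (⟨j, by omega⟩ : Fin n) ⟨j + 1, hj⟩
        (fun h => by have := congrArg Fin.val h; simp at this) c : GL (Fin n) R) : Matrix (Fin n) (Fin n) R) = c := by
  classical
  rw [coe_transvectionUnit]
  unfold superdiagSumFrom
  rw [Finset.sum_eq_single (⟨j + 1, hj⟩ : Fin n)]
  · rw [dif_pos ⟨by simp, by simp⟩, Matrix.add_apply, Matrix.one_apply_ne (fun h => by
      have := congrArg Fin.val h; simp at this), zero_add, Matrix.single_apply, if_pos]
    exact ⟨Fin.ext (by simp), rfl⟩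
  · intro b _ hb
    by_cases h : 1 ≤ (b : ℕ) ∧ 0 < (b : ℕ)
    · rw [dif_pos h, Matrix.add_apply, Matrix.one_apply_ne (fun h' => by
        have := congrArg Fin.val h'; simp at this; omega), zero_add, Matrix.single_apply, if_neg]
      rintro ⟨h1, h2⟩
      exact hb h2.symm
    · rw [dif_neg h]
  · intro h; exact absurd (Finset.mem_univ _) h

end Transvection

/-! ### Local congruence subgroups: elementary unipotents and normality -/

section Local

variable {n : ℕ} {F : Type*} [Field F] {Γ₀ : Type*} [LinearOrderedCommGroupWithZero Γ₀] [Valued F Γ₀]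

/-- **`1 + c E_{ij}` lies in the valued congruence subgroup of radius `r`** when `|c| ≤ r ≤ 1`.
[folklore] -/
theorem transvectionUnit_mem_valuedCongruenceSubgroup {i j : Fin n} (hij : i ≠ j) {c : F} {r : Γ₀}
    (hc : Valued.v c ≤ r) (hr : r ≤ 1) :
    transvectionUnit i j hij c ∈ valuedCongruenceSubgroup (Fin n) r := by
  have hone : ∀ a b : Fin n, Valued.v ((1 : Matrix (Fin n) (Fin n) F) a b) ≤ 1 := fun a b => by
    rw [Matrix.one_apply]; split_ifs <;> simp
  have hsingle : ∀ (d : F), Valued.v d ≤ r → ∀ a b : Fin n, Valued.v (Matrix.single i j d a b) ≤ r :=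
    fun d hd a b => by rw [Matrix.single_apply]; split_ifs <;> simp [hd]
  have hentry : ∀ (d : F), Valued.v d ≤ r → ∀ a b : Fin n,
      Valued.v (((transvectionUnit i j hij d : GL (Fin n) F) : Matrix (Fin n) (Fin n) F) a b) ≤ 1 :=
    fun d hd a b => by
      rw [coe_transvectionUnit, Matrix.add_apply]
      exact (Valued.v.map_add_le (hone a b) ((hsingle d hd a b).trans hr))
  refine ⟨hentry c hc, fun a b => ?_, fun a b => ?_⟩
  · rw [transvectionUnit_inv]
    exact hentry (-c) (by rwa [Valuation.map_neg]) a b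
  · rw [coe_transvectionUnit, add_sub_cancel_left]
    exact hsingle c hc a b

/-- **The valued congruence subgroups are normalised by `GL_n(𝒪_F)`**: for `k` of radius `1` and `u`
of radius `r`, `k⁻¹ u k` has radius `r` (`k⁻¹ u k - 1 = k⁻¹ (u - 1) k`, ultrametric inequality).
[folklore] -/
theorem inv_mul_mul_mem_valuedCongruenceSubgroup {k u : GL (Fin n) F} {r : Γ₀}
    (hk : k ∈ valuedCongruenceSubgroup (Fin n) (1 : Γ₀)) (hu : u ∈ valuedCongruenceSubgroup (Fin n) r) :
    k⁻¹ * u * k ∈ valuedCongruenceSubgroup (Fin n) r := by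
  obtain ⟨hk₁, hk₂, -⟩ := hk
  obtain ⟨hu₁, hu₂, hu₃⟩ := hu
  refine ⟨fun a b => ?_, fun a b => ?_, fun a b => ?_⟩
  · rw [Units.val_mul, Units.val_mul]
    simpa using valued_mul_apply_le (Fin n) (valued_mul_apply_le (Fin n) hk₂ hu₁) hk₁ a b
  · rw [_root_.mul_inv_rev, _root_.mul_inv_rev, inv_inv, ← mul_assoc, Units.val_mul, Units.val_mul]
    simpa using valued_mul_apply_le (Fin n) (valued_mul_apply_le (Fin n) hk₂ hu₂) hk₁ a b
  · have e : ((k⁻¹ * u * k : GL (Fin n) F) : Matrix (Fin n) (Fin n) F) - 1 =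
        ((k⁻¹ : GL (Fin n) F) : Matrix (Fin n) (Fin n) F) * ((u : Matrix (Fin n) (Fin n) F) - 1) *
          (k : Matrix (Fin n) (Fin n) F) := by
      rw [Units.val_mul, Units.val_mul, Matrix.mul_sub, Matrix.sub_mul, Matrix.mul_one, Units.inv_mul]
    rw [e]
    simpa using valued_mul_apply_le (Fin n) (valued_mul_apply_le (Fin n) hk₂ hu₃) hk₁ a b

end Local

/-! ### The adelic principal congruence subgroups -/

section Level

variable {n : ℕ} {K : Type} [Field K] [NumberField K]

/-- **`K(𝔫)` is normalised by `GL_n(𝒪̂_K)`**: `(1, k)⁻¹ κ (1, k) ∈ K(𝔫)` for `κ ∈ K(𝔫)` and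
`k ∈ GL_n(𝒪̂_K)`. [folklore] -/
theorem inv_mul_mul_mem_principalCongruenceLevel {𝔫 : Ideal (𝓞 K)} {κ : GL (Fin n) (AdeleRing (𝓞 K) K)}
    (hκ : κ ∈ principalCongruenceLevel n K 𝔫) {k : GL (Fin n) (FiniteAdeleRing (𝓞 K) K)}
    (hk : k ∈ glFiniteIntegralLevel n K) :
    (GLn.ofFinite n K k)⁻¹ * κ * GLn.ofFinite n K k ∈ principalCongruenceLevel n K 𝔫 := by
  have hk' : GLn.ofFinite n K k ∈ glIntegralLevel n K := GLn.ofFinite_mem_glIntegralLevel hk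
  rw [mem_principalCongruenceLevel_iff] at hκ ⊢
  refine ⟨(glIntegralLevel n K).mul_mem ((glIntegralLevel n K).mul_mem ((glIntegralLevel n K).inv_mem hk') hκ.1) hk',
    fun v => ?_⟩
  have h1 := toLocal_mem_valuedCongruenceSubgroup_one hk' v
  have h2 := hκ.2 v
  change Matrix.GeneralLinearGroup.map (AdelicGroupData.adeleEval K v) _ ∈ _ at h1 h2 ⊢
  rw [map_mul, map_mul, map_inv]
  exact inv_mul_mul_mem_valuedCongruenceSubgroup h1 h2

/-- The local component of `(1, 1 + c E_{ij})` at `v` is `1 + c_v E_{ij}`. [folklore] -/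
theorem toLocal_ofFinite_transvectionUnit (i j : Fin n) (hij : i ≠ j) (c : FiniteAdeleRing (𝓞 K) K)
    (v : HeightOneSpectrum (𝓞 K)) :
    (AdelicGroupData.gl n K).toLocal v (GLn.ofFinite n K (transvectionUnit i j hij c)) =
      transvectionUnit i j hij (c v) := by
  change Matrix.GeneralLinearGroup.map (AdelicGroupData.adeleEval K v) (GLn.ofFinite n K (transvectionUnit i j hij c)) = _
  refine Units.ext (Matrix.ext fun a b => ?_)
  rw [Matrix.GeneralLinearGroup.map_apply, GLn.coe_ofFinite_apply, AdelicGroupData.adeleEval_apply]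
  dsimp only
  rw [coe_transvectionUnit, coe_transvectionUnit, Matrix.add_apply, Matrix.add_apply, Matrix.one_apply,
    Matrix.one_apply, Matrix.single_apply, Matrix.single_apply]
  split_ifs <;> rfl

/-- **`(1, 1 + c E_{ij}) ∈ K(𝔫)` when `|c_v|_v ≤ |𝔫|_v` for every `v`.** [folklore] -/
theorem ofFinite_transvectionUnit_mem_principalCongruenceLevel {𝔫 : Ideal (𝓞 K)} (i j : Fin n) (hij : i ≠ j)
    {c : FiniteAdeleRing (𝓞 K) K} (hc : ∀ v : HeightOneSpectrum (𝓞 K), Valued.v (c v) ≤ idealRadius K v 𝔫) :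
    GLn.ofFinite n K (transvectionUnit i j hij c) ∈ principalCongruenceLevel n K 𝔫 := by
  have hcint : c ∈ integralFiniteAdeles K := fun v =>
    (HeightOneSpectrum.mem_adicCompletionIntegers (R := 𝓞 K) K v).2 ((hc v).trans (idealRadius_le_one K v 𝔫))
  have hmem : transvectionUnit i j hij c ∈ glFiniteIntegralLevel n K := by
    have hent : ∀ (d : FiniteAdeleRing (𝓞 K) K), d ∈ integralFiniteAdeles K → ∀ a b : Fin n,
        ((transvectionUnit i j hij d : GL (Fin n) (FiniteAdeleRing (𝓞 K) K)) :
          Matrix (Fin n) (Fin n) (FiniteAdeleRing (𝓞 K) K)) a b ∈ integralFiniteAdeles K := by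
      intro d hd a b
      rw [coe_transvectionUnit, Matrix.add_apply, Matrix.one_apply, Matrix.single_apply]
      split_ifs <;> simp [hd, (integralFiniteAdeles K).one_mem, (integralFiniteAdeles K).zero_mem,
        (integralFiniteAdeles K).add_mem]
    refine mem_glFiniteIntegralLevel_iff.2 ⟨hent c hcint, fun a b => ?_⟩
    rw [transvectionUnit_inv]
    exact hent (-c) ((integralFiniteAdeles K).neg_mem hcint) a b
  rw [mem_principalCongruenceLevel_iff]
  refine ⟨GLn.ofFinite_mem_glIntegralLevel hmem, fun v => ?_⟩
  rw [toLocal_ofFinite_transvectionUnit]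
  exact transvectionUnit_mem_valuedCongruenceSubgroup hij (hc v) (idealRadius_le_one K v 𝔫)

end Level

/-! ### The Whittaker tower: right invariance and the elementary unipotents -/

section Whittaker

variable {n : ℕ} {K : Type} [Field K] [NumberField K]
variable [MeasurableSpace (GL (Fin n) (AdeleRing (𝓞 K) K))] [BorelSpace (GL (Fin n) (AdeleRing (𝓞 K) K))]

/-- **Right translation commutes with the column transforms**: `T_c (f(· u)) (g) = T_c f (g u)`.
[folklore] -/
theorem colTransform_comp_mul_right (c : ℕ) (hc : c < n) (hc0 : 0 < c)
    (f : GL (Fin n) (AdeleRing (𝓞 K) K) → ℂ) (u g : GL (Fin n) (AdeleRing (𝓞 K) K)) :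
    colTransform (K := K) c hc hc0 (fun x => f (x * u)) g = colTransform (K := K) c hc hc0 f (g * u) := by
  rw [colTransform_eq, colTransform_eq]
  congr 1
  refine setIntegral_congr_fun measurableSet_colRangeTateDomain fun y _ => ?_
  simp only [colIntegrand, mul_assoc]

/-- **Right translation commutes with the Whittaker tower**:
`whittakerIter k (f(· u)) (g) = whittakerIter k f (g u)`. [folklore] -/
theorem whittakerIter_comp_mul_right (f : GL (Fin n) (AdeleRing (𝓞 K) K) → ℂ) (u : GL (Fin n) (AdeleRing (𝓞 K) K)) :
    ∀ (k : ℕ) (g : GL (Fin n) (AdeleRing (𝓞 K) K)),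
      whittakerIter (K := K) k (fun x => f (x * u)) g = whittakerIter (K := K) k f (g * u)
  | 0, g => rfl
  | k + 1, g => by
    by_cases h : n - (k + 1) < n ∧ 0 < n - (k + 1)
    · simp only [whittakerIter, dif_pos h]
      have e : whittakerIter (K := K) k (fun x => f (x * u)) = fun x => whittakerIter (K := K) k f (x * u) :=
        funext fun x => whittakerIter_comp_mul_right f u k x
      rw [e, colTransform_comp_mul_right]
    · simp only [whittakerIter, dif_neg h]
      exact whittakerIter_comp_mul_right f u k g

/-- **The Whittaker function of a right-`u`-invariant function is right-`u`-invariant**: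
`Φ_d(g u) = Φ_d(g)` whenever `φ(x u) = φ(x)` for all `x`. [folklore] -/
theorem whittakerDepth_mul_right_eq {φ : GL (Fin n) (AdeleRing (𝓞 K) K) → ℂ} {u : GL (Fin n) (AdeleRing (𝓞 K) K)}
    (hu : ∀ x, φ (x * u) = φ x) (d : ℕ) (g : GL (Fin n) (AdeleRing (𝓞 K) K)) :
    whittakerDepth (K := K) d φ (g * u) = whittakerDepth (K := K) d φ g := by
  unfold whittakerDepth
  rw [← whittakerIter_comp_mul_right φ u _ g]
  have e : (fun x => φ (x * u)) = φ := funext hu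
  rw [e]

/-- **`W_φ((1 + s E_{j,j+1}) g) = ψ(s) W_φ(g)`** for `φ` left `GL_n(K)`-invariant and `s ∈ 𝔸_K`
(`(N, ψ)`-equivariance of the Whittaker function). [cite: CogdellAnalyticTheory2004, §1.1] -/
theorem whittakerDepth_zero_transvectionUnit_mul {φ : GL (Fin n) (AdeleRing (𝓞 K) K) → ℂ}
    (hφK : ∀ (γ₀ : GL (Fin n) K) (x : GL (Fin n) (AdeleRing (𝓞 K) K)),
      φ (Matrix.GeneralLinearGroup.map (algebraMap K (AdeleRing (𝓞 K) K)) γ₀ * x) = φ x)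
    {j : ℕ} (hj : j + 1 < n) (s : AdeleRing (𝓞 K) K) (g : GL (Fin n) (AdeleRing (𝓞 K) K)) :
    whittakerDepth 0 φ (transvectionUnit (⟨j, by omega⟩ : Fin n) ⟨j + 1, hj⟩
        (fun h => by have := congrArg Fin.val h; simp at this) s * g) =
      (adeleAddChar K s : ℂ) * whittakerDepth 0 φ g := by
  have hmem : transvectionUnit (⟨j, by omega⟩ : Fin n) ⟨j + 1, hj⟩
      (fun h => by have := congrArg Fin.val h; simp at this) s ∈ adelicColRange n K 1 (n - 1) := by
    change _ ∈ unipotentColRange n (AdeleRing (𝓞 K) K) 1 (n - 1)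
    rw [unipotentColRange_one_eq_upperUnitriangular]
    exact transvectionUnit_mem_upperUnitriangular (Fin.mk_lt_mk.2 (Nat.lt_succ_self j)) s
  rw [whittakerDepth_colRange_mul hφK (d := 0) (by omega) hmem g, unipotentCharFrom_apply,
    superdiagSumFrom_one_transvectionUnit hj s]

/-- **Support of the Whittaker function at the finite places** (the finite half of the estimates
behind the absolute convergence of the Fourier expansion, Cogdell (2004), Thm. 1.1). Let `φ` be left
`GL_n(K)`-invariant and right `K(𝔫)`-invariant, `W_φ = whittakerDepth 0 φ`, and let `g ∈ GL_n(𝔸_K)`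
have finite component `g_f = diag(t) · k` with `k ∈ GL_n(𝒪̂_K)`. For a finite place `v`, a simple
root `(j, j+1)` and `x ∈ K_v` with `ψ_v(x) ≠ 1`: if `W_φ(g) ≠ 0` then
`|t_j|_v · |𝔫|_v < |x|_v · |t_{j+1}|_v`. (Otherwise `u = 1 + x E_{j,j+1}` at `v` has
`g⁻¹ u g = (1, k⁻¹ (1 + t_j⁻¹ x t_{j+1} E_{j,j+1}) k) ∈ K(𝔫)`, whence
`W_φ(g) = W_φ(u g) = ψ_v(x) W_φ(g)`.) [cite: CogdellAnalyticTheory2004, Thm. 1.1] -/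
theorem valued_lt_of_whittakerDepth_zero_ne_zero {φ : GL (Fin n) (AdeleRing (𝓞 K) K) → ℂ}
    (hφK : ∀ (γ₀ : GL (Fin n) K) (x : GL (Fin n) (AdeleRing (𝓞 K) K)),
      φ (Matrix.GeneralLinearGroup.map (algebraMap K (AdeleRing (𝓞 K) K)) γ₀ * x) = φ x)
    {𝔫 : Ideal (𝓞 K)} (hφU : ∀ x, ∀ u ∈ principalCongruenceLevel n K 𝔫, φ (x * u) = φ x)
    {g : GL (Fin n) (AdeleRing (𝓞 K) K)} {t : Fin n → (FiniteAdeleRing (𝓞 K) K)ˣ}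
    {k : GL (Fin n) (FiniteAdeleRing (𝓞 K) K)} (hk : k ∈ glFiniteIntegralLevel n K)
    (hg : GLn.sndHom n K g = glDiagonal n (FiniteAdeleRing (𝓞 K) K) t * k)
    (hW : whittakerDepth 0 φ g ≠ 0) (v : HeightOneSpectrum (𝓞 K)) {j : ℕ} (hj : j + 1 < n)
    {x : v.adicCompletion K} (hx : adeleAddCharAt K v x ≠ 1) :
    Valued.v (((t ⟨j, by omega⟩ : (FiniteAdeleRing (𝓞 K) K)ˣ) : FiniteAdeleRing (𝓞 K) K) v) * idealRadius K v 𝔫 <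
      Valued.v x * Valued.v (((t ⟨j + 1, hj⟩ : (FiniteAdeleRing (𝓞 K) K)ˣ) : FiniteAdeleRing (𝓞 K) K) v) := by
  by_contra hle
  rw [not_lt] at hle
  -- notation
  set i₀ : Fin n := ⟨j, by omega⟩ with hi₀
  set i₁ : Fin n := ⟨j + 1, hj⟩ with hi₁
  have hne : i₀ ≠ i₁ := fun h => by have := congrArg Fin.val h; simp [hi₀, hi₁] at this
  set s : AdeleRing (𝓞 K) K := adeleSingleHom K v x with hs
  set u : GL (Fin n) (AdeleRing (𝓞 K) K) := transvectionUnit i₀ i₁ hne s with hu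
  -- the conjugate `g⁻¹ u g` and its finite part
  set c : FiniteAdeleRing (𝓞 K) K := (((t i₀)⁻¹ : (FiniteAdeleRing (𝓞 K) K)ˣ) : FiniteAdeleRing (𝓞 K) K) *
    s.2 * (t i₁ : FiniteAdeleRing (𝓞 K) K) with hcdef
  have hsnd : GLn.sndHom n K (g⁻¹ * u * g) = k⁻¹ * transvectionUnit i₀ i₁ hne c * k := by
    rw [map_mul, map_mul, map_inv, hg, hu, map_transvectionUnit, _root_.mul_inv_rev]
    change k⁻¹ * (glDiagonal n (FiniteAdeleRing (𝓞 K) K) t)⁻¹ * transvectionUnit i₀ i₁ hne s.2 *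
      (glDiagonal n (FiniteAdeleRing (𝓞 K) K) t * k) = _
    rw [← glDiagonal_inv_mul_transvectionUnit_mul_glDiagonal t i₀ i₁ hne s.2]
    simp only [mul_assoc]
  have hfst : GLn.fstHom n K (g⁻¹ * u * g) = 1 := by
    rw [map_mul, map_mul, map_inv, hu, map_transvectionUnit]
    change (GLn.fstHom n K g)⁻¹ * transvectionUnit i₀ i₁ hne s.1 * GLn.fstHom n K g = 1
    rw [hs, adeleSingleHom_apply_fst, transvectionUnit_zero, mul_one, inv_mul_cancel]
  have hconj : g⁻¹ * u * g = (GLn.ofFinite n K k)⁻¹ * GLn.ofFinite n K (transvectionUnit i₀ i₁ hne c) *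
      GLn.ofFinite n K k := by
    rw [← map_inv, ← map_mul, ← map_mul, ← hsnd]
    exact GLn.ext_of_fstHom_of_sndHom (by rw [hfst, GLn.fstHom_ofFinite]) (by rw [GLn.sndHom_ofFinite])
  -- the valuations of `c`
  have hc : ∀ w : HeightOneSpectrum (𝓞 K), Valued.v (c w) ≤ idealRadius K w 𝔫 := by
    intro w
    rw [hcdef]
    rw [show ((((t i₀)⁻¹ : (FiniteAdeleRing (𝓞 K) K)ˣ) : FiniteAdeleRing (𝓞 K) K) * s.2 *
        (t i₁ : FiniteAdeleRing (𝓞 K) K)) w =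
        ((((t i₀)⁻¹ : (FiniteAdeleRing (𝓞 K) K)ˣ) : FiniteAdeleRing (𝓞 K) K) w) * s.2 w *
          ((t i₁ : FiniteAdeleRing (𝓞 K) K) w) from rfl]
    rw [hs, adeleSingleHom_apply_snd]
    by_cases hw : w = v
    · subst hw
      rw [finiteAdeleSingleHom_apply_self, map_mul, map_mul]
      -- `|t_j|⁻¹ |x| |t_{j+1}| ≤ |𝔫|_v`
      have ht0 : Valued.v (((t i₀ : (FiniteAdeleRing (𝓞 K) K)ˣ) : FiniteAdeleRing (𝓞 K) K) w) ≠ 0 := by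
        rw [Valuation.ne_zero_iff]
        have h := congrArg (fun z : FiniteAdeleRing (𝓞 K) K => z w) (t i₀).mul_inv
        change ((t i₀ : FiniteAdeleRing (𝓞 K) K) w) * ((((t i₀)⁻¹ : (FiniteAdeleRing (𝓞 K) K)ˣ) :
          FiniteAdeleRing (𝓞 K) K) w) = (1 : FiniteAdeleRing (𝓞 K) K) w at h
        intro h0
        rw [h0, zero_mul] at h
        exact zero_ne_one (h.trans rfl)
      have hinv : Valued.v ((((t i₀)⁻¹ : (FiniteAdeleRing (𝓞 K) K)ˣ) : FiniteAdeleRing (𝓞 K) K) w) =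
          (Valued.v (((t i₀ : (FiniteAdeleRing (𝓞 K) K)ˣ) : FiniteAdeleRing (𝓞 K) K) w))⁻¹ := by
        refine eq_inv_of_mul_eq_one_left ?_
        rw [← map_mul]
        have h := congrArg (fun z : FiniteAdeleRing (𝓞 K) K => z w) (t i₀).inv_mul
        change ((((t i₀)⁻¹ : (FiniteAdeleRing (𝓞 K) K)ˣ) : FiniteAdeleRing (𝓞 K) K) w) *
          ((t i₀ : FiniteAdeleRing (𝓞 K) K) w) = (1 : FiniteAdeleRing (𝓞 K) K) w at h
        rw [h]
        exact Valued.v.map_one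
      rw [hinv, mul_assoc, inv_mul_le_iff₀ (zero_lt_iff.2 ht0)]
      exact hle
    · rw [finiteAdeleSingleHom_apply_of_ne K v x hw, mul_zero, zero_mul, Valuation.map_zero]
      exact zero_le
  -- `g⁻¹ u g ∈ K(𝔫)`, so `W(u g) = W(g)`
  have hmem : g⁻¹ * u * g ∈ principalCongruenceLevel n K 𝔫 := by
    rw [hconj]
    exact inv_mul_mul_mem_principalCongruenceLevel
      (ofFinite_transvectionUnit_mem_principalCongruenceLevel i₀ i₁ hne hc) hk
  have h1 : whittakerDepth 0 φ (u * g) = whittakerDepth 0 φ g := by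
    have e : u * g = g * (g⁻¹ * u * g) := by simp only [mul_assoc, mul_inv_cancel_left]
    rw [e]
    exact whittakerDepth_mul_right_eq (fun y => hφU y _ hmem) 0 g
  -- `W(u g) = ψ_v(x) W(g)`
  have h2 : whittakerDepth 0 φ (u * g) = (adeleAddCharAt K v x : ℂ) * whittakerDepth 0 φ g :=
    whittakerDepth_zero_transvectionUnit_mul hφK hj s g
  rw [h1] at h2
  have h3 : ((adeleAddCharAt K v x : ℂ) - 1) * whittakerDepth 0 φ g = 0 := by rw [sub_mul, one_mul, ← h2, sub_self]
  rcases mul_eq_zero.1 h3 with h4 | h4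
  · exact hx (Circle.ext (by rwa [sub_eq_zero] at h4))
  · exact hW h4

end Whittaker

end Literature.NumberTheory.Automorphic
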